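import Summits.CriticalPhenomena.PercolationContinuityZ3.Theorems.PercNearOneGluingNoHeavyLowerTailQ44SingleSourceOffCore
import Summits.CriticalPhenomena.PercolationContinuityZ3.Theorems.PercNearOneGluingNoHeavyLowerTailNineTypeTwoMapCount

/-!
# Base schemes for the single-source packing: free `cy`-kernels and symmetric schemes with `K4s`-, `ab|c|y`- and lobe bases

Support file for crux `stmt-CriticalPhenomena-4575` (master-family programme, row `Q44`, single-source packing
`g ≥ b1 + h_a`), seat `prim-bnk-1` gen 29; memo `run/shared/lean/prim/prim-l12/FROM-prim-bnk-1-gen29-BASE-SCHEMES.md` §2.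

The single-source family at source `a` consists of sides of the seven oriented types (cell ; co-cell)
`Pb = (6,7)`, `Pc = (5,7)`, `K1[ab|cy] = (11,9)`, `K2[ab|cy] = (11,8)`, `K4[ab] = (6,8)`, `K5[ab] = (6,1)`, `K4s[ay|bc] = (8,1)`.
Gen 27/28 reduced the full law to odd targets on two cores (`pack_singleSource_of_cores`).  The abstract engine behind
every certificate found so far is `exists_odd_good_of_handshake` (gen 27) read as a SYMMETRIC SCHEME: for a member `X₀`
contained in no other member and an anchor `A ⊆ X₀`, the kernels `K_S = A ∪ (X₀ \ S)` have
`Σ_S #{S' ⊇ K_S} ≡ #{S ⊇ X₀} = 1 (mod 2)`, so some kernel has odd containment count, and only VALIDITY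
(`S' ∪ K_Sᶜ` good) has to be supplied.  This file supplies validity for three new bases and isolates the kernel class
behind all `K4s`-based certificates:

* `exists_odd_good_of_cyKernel` — for families avoiding `Pc`, EVERY set `K` of cell `⊥` whose complement joins `c–y`
  (`ple (a|b|cy) (ι Kᶜ)`) is a valid kernel (a strict enlargement of the co-goods); graph form
  `exists_odd_good_of_sub_K4s`: every sub-kernel of cell `⊥` of a `K4s`-side is free.
* `exists_odd_good_symmetric_K4s` — base `W₀` of co-cell `a|b|cy` (a maximal `K4s`-member): odd target as soon as every
  `W₀ \ S` (`S ∈ 𝒮`) has cell `⊥` (automatic for `K1, K5, K4s`-members; for `K2/K4`-members it says that `W₀ ∖ S`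
  contains no `a–y` and no `b–c` path).
* `exists_odd_good_symmetric_abcy` — base `X₀` of cell `ab|c|y` (types `Pb, K4, K5`): odd target as soon as every
  `S ∪ (M \ X₀)` is an AC cell; corollaries `exists_odd_good_of_maximal_Pb` (a `Pb`-member contained in no other member
  certifies EVERY family of the seven types — the decision-list branch B1 without its proviso `K5 ∉ τ`) and
  `exists_odd_good_K4base_linked` (a maximal `K4`-base certifies as soon as every `K4s`-member `W` is linked:
  `a ~ b` in `(M \ X₀) ∪ W`).

Memo §3 records the evidence that the cores are ALWAYS certified by a sub-kernel of the maximal `K4s`-member of size ≤ 2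
(`R7-W(2)`, 0 exceptions) — `exists_odd_good_of_sub_K4s` is the Lean half of that certificate.
No sorries, no definitions, standard axioms.
-/

namespace Summit.CriticalPhenomena.PercolationContinuityZ3.Theorems

namespace TwoCopyMono

open Finset FourPointAtoms KernelPeeling Literature.Probability.Percolation

/-! ## Table facts -/

/-- `upAC` is monotone in its second argument. [this work] -/
theorem upAC_mono_right {h l l' : Fin 15} (hle : ple l l' = true) (hu : upAC h l = true) : upAC h l' = true := by
  unfold upAC at hu ⊢
  rw [decide_eq_true_iff] at hu ⊢
  exact fun x hx hx' => hu x hx (ple_trans hle hx')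

/-- The AC cells form an up-set of the cell order (table fact). [this work] -/
theorem isAC_of_ple : ∀ i j : Fin 15, ple i j = true → isAC i → isAC j := by
  decide

/-- Table: a kernel of cells `(⊥ ; ≥ a|b|cy)` is compatible with the six single-source types other than `Pc`
(`upAC h (a|b|cy)` for `h ∈ {ab|c|y, ab|cy, ay|bc}`; `downBot l ⊥` always). [this work] -/
theorem cyKernel_table :
    ∀ q ∈ ({(6, 7), (11, 9), (11, 8), (6, 8), (6, 1), (8, 1)} : Finset (Fin 15 × Fin 15)),
      upAC q.1 1 = true ∧ downBot q.2 0 = true := by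
  decide +kernel

/-- Table: the six non-`Pc` types are single-source types. [this work] -/
theorem six_subset_seven :
    ∀ q ∈ ({(6, 7), (11, 9), (11, 8), (6, 8), (6, 1), (8, 1)} : Finset (Fin 15 × Fin 15)),
      q ∈ ({(6, 7), (5, 7), (11, 9), (11, 8), (6, 8), (6, 1), (8, 1)} : Finset (Fin 15 × Fin 15)) := by
  decide +kernel

/-- Table: with a co-cell `ay|bc` on the right, every single-source cell other than `ay|bc` joins to an AC cell. [this work] -/
theorem upAC_eight_table :
    ∀ q ∈ ({(6, 7), (5, 7), (11, 9), (11, 8), (6, 8), (6, 1), (8, 1)} : Finset (Fin 15 × Fin 15)),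
      q.1 ≠ 8 → upAC q.1 8 = true := by
  decide +kernel

/-! ## Free `cy`-kernels (cell-map form) -/

/-- **`cy`-kernel certificate.**  `ι` a monotone cell map, `𝒮` a family of sets of the six non-`Pc` single-source types,
`K` a set of cell `⊥` whose complement has cell `≥ a|b|cy`.  If `K` is contained in an odd number of members of `𝒮`,
then some good of `ι` contains an odd number of members. [this work] -/
theorem exists_odd_good_of_cyKernel {γ : Type} [Fintype γ] [DecidableEq γ] (ι : Finset γ → Fin 15)
    (hmono : ∀ A B : Finset γ, A ⊆ B → ple (ι A) (ι B) = true) (𝒮 : Finset (Finset γ))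
    (htypes : ∀ S ∈ 𝒮, (ι S, ι Sᶜ) ∈ ({(6, 7), (11, 9), (11, 8), (6, 8), (6, 1), (8, 1)} : Finset (Fin 15 × Fin 15)))
    (K : Finset γ) (hK0 : ι K = 0) (hK1 : ple 1 (ι Kᶜ) = true)
    (hodd : Odd #(𝒮.filter (fun S => K ⊆ S))) : ∃ T ∈ goods ι, Odd #(𝒮.filter (fun S => S ⊆ T)) := by
  refine exists_odd_good_of_subkernel ι hmono 𝒮 (subset_refl K) (fun S hS => ?_) hodd
  have h := cyKernel_table (ι S, ι Sᶜ) (htypes S hS)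
  refine ⟨upAC_mono_right hK1 h.1, ?_⟩
  rw [hK0]; exact h.2

variable {n : ℕ}

/-! ## Graph fibres: sub-kernels of a `K4s`-side -/

/-- **Sub-kernels of cell `⊥` of a `K4s`-side are free.**  Graph fibre `(M, C)` with labelling `ι`; `𝒮` a family of sides
of the six non-`Pc` single-source types; `W ⊆ M` with co-cell `ι (M \ W) = a|b|cy`; `K ⊆ W` with `ι K = ⊥` (no `a–y`
and no `b–c` path inside `K`).  If `K` lies in an odd number of members, some fat good contains an odd number of members.
[this work] -/
theorem exists_odd_good_of_sub_K4s (a b c y : Fin n) (C M : Finset (Sym2 (Fin n)))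
    (ι : Finset (Sym2 (Fin n)) → Fin 15) (hι : ∀ T : Finset (Sym2 (Fin n)), prof a b c y ↑(C ∪ T) = pp (ι T))
    (𝒮 : Finset (Finset (Sym2 (Fin n)))) (h𝒮M : ∀ S ∈ 𝒮, S ⊆ M)
    (htypes : ∀ S ∈ 𝒮, (ι S, ι (M \ S)) ∈ ({(6, 7), (11, 9), (11, 8), (6, 8), (6, 1), (8, 1)} : Finset (Fin 15 × Fin 15)))
    (W : Finset (Sym2 (Fin n))) (hWM : W ⊆ M) (hWc : ι (M \ W) = 1)
    (K : Finset (Sym2 (Fin n))) (hKW : K ⊆ W) (hK0 : ι K = 0)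
    (hodd : Odd #(𝒮.filter (fun S => K ⊆ S))) :
    ∃ T ∈ goods (fun T : Finset (Sym2 (Fin n)) => ι (T ∩ M)), Odd #(𝒮.filter (fun S => S ⊆ T)) := by
  classical
  set κ : Finset (Sym2 (Fin n)) → Fin 15 := fun T => ι (T ∩ M) with hκ
  have hmono : ∀ A B : Finset (Sym2 (Fin n)), A ⊆ B → ple (κ A) (κ B) = true := fun A B hAB =>
    ple_fibreMap a b c y C ι hι (Finset.inter_subset_inter hAB (subset_refl M))
  have hκS : ∀ S, S ⊆ M → κ S = ι S := fun S hS => by simp only [hκ, Finset.inter_eq_left.2 hS]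
  have hκSc : ∀ S : Finset (Sym2 (Fin n)), κ Sᶜ = ι (M \ S) := fun S => by
    simp only [hκ]; congr 1; ext e; simp [Finset.mem_sdiff, Finset.mem_inter, and_comm]
  have htypes' : ∀ S ∈ 𝒮, (κ S, κ Sᶜ) ∈
      ({(6, 7), (11, 9), (11, 8), (6, 8), (6, 1), (8, 1)} : Finset (Fin 15 × Fin 15)) := by
    intro S hS
    rw [hκS S (h𝒮M S hS), hκSc S]
    exact htypes S hS
  have hK0' : κ K = 0 := by rw [hκS K (hKW.trans hWM)]; exact hK0
  have hK1' : ple 1 (κ Kᶜ) = true := by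
    have h := hmono Wᶜ Kᶜ (Finset.compl_subset_compl.2 hKW)
    rwa [hκSc W, hWc] at h
  exact exists_odd_good_of_cyKernel κ hmono 𝒮 htypes' K hK0' hK1' hodd

/-! ## Symmetric scheme with a `K4s` base -/

/-- **Symmetric scheme, base of co-cell `a|b|cy`.**  Graph fibre; `𝒮` of the six non-`Pc` types; `W₀ ∈ 𝒮` with
`ι (M \ W₀) = a|b|cy`, contained in no other member; and for every member `S`, the set `W₀ \ S` has cell `⊥`.
Then some fat good contains an odd number of members.  (Kernels `K_S = W₀ \ S`;
`exists_odd_good_of_handshake` with empty anchor.) [this work] -/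
theorem exists_odd_good_symmetric_K4s (a b c y : Fin n) (C M : Finset (Sym2 (Fin n)))
    (ι : Finset (Sym2 (Fin n)) → Fin 15) (hι : ∀ T : Finset (Sym2 (Fin n)), prof a b c y ↑(C ∪ T) = pp (ι T))
    (𝒮 : Finset (Finset (Sym2 (Fin n)))) (h𝒮M : ∀ S ∈ 𝒮, S ⊆ M)
    (htypes : ∀ S ∈ 𝒮, (ι S, ι (M \ S)) ∈ ({(6, 7), (11, 9), (11, 8), (6, 8), (6, 1), (8, 1)} : Finset (Fin 15 × Fin 15)))
    (W₀ : Finset (Sym2 (Fin n))) (hW₀ : W₀ ∈ 𝒮) (hW₀c : ι (M \ W₀) = 1)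
    (hmax : ∀ S ∈ 𝒮, W₀ ⊆ S → S = W₀)
    (hfree : ∀ S ∈ 𝒮, ι (W₀ \ S) = 0) :
    ∃ T ∈ goods (fun T : Finset (Sym2 (Fin n)) => ι (T ∩ M)), Odd #(𝒮.filter (fun S => S ⊆ T)) := by
  classical
  set κ : Finset (Sym2 (Fin n)) → Fin 15 := fun T => ι (T ∩ M) with hκ
  have hmono : ∀ A B : Finset (Sym2 (Fin n)), A ⊆ B → ple (κ A) (κ B) = true := fun A B hAB =>
    ple_fibreMap a b c y C ι hι (Finset.inter_subset_inter hAB (subset_refl M))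
  have hκS : ∀ S, S ⊆ M → κ S = ι S := fun S hS => by simp only [hκ, Finset.inter_eq_left.2 hS]
  have hκSc : ∀ S : Finset (Sym2 (Fin n)), κ Sᶜ = ι (M \ S) := fun S => by
    simp only [hκ]; congr 1; ext e; simp [Finset.mem_sdiff, Finset.mem_inter, and_comm]
  have hW₀M : W₀ ⊆ M := h𝒮M W₀ hW₀
  refine exists_odd_good_of_handshake (goods κ) (goods_upper κ hmono) 𝒮 ∅ W₀ hW₀ (Finset.empty_subset _) hmax ?_
  intro X hX _ S hS
  rw [Finset.empty_union]
  have hq := cyKernel_table (ι S, ι (M \ S)) (htypes S hS)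
  refine union_compl_mem_goods_of_compatible κ hmono (subset_refl (W₀ \ X)) ?_ ?_
  · have h1 : ple 1 (κ (W₀ \ X)ᶜ) = true := by
      have h := hmono W₀ᶜ (W₀ \ X)ᶜ (Finset.compl_subset_compl.2 Finset.sdiff_subset)
      rwa [hκSc W₀, hW₀c] at h
    rw [hκS S (h𝒮M S hS)]
    exact upAC_mono_right h1 hq.1
  · rw [hκS (W₀ \ X) (Finset.sdiff_subset.trans hW₀M), hfree X hX, hκSc S]
    exact hq.2

/-! ## Symmetric scheme with a base of cell `ab|c|y` -/

/-- **Symmetric scheme, base of cell `ab|c|y`.**  Graph fibre; `𝒮` of the seven single-source types; `X₀ ∈ 𝒮` with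
`ι X₀ = ab|c|y`, contained in no other member; and for every member `S` the cell of `S ∪ (M \ X₀)` is AC.  Then some fat
good contains an odd number of members.  (Kernels `K_S = X₀ \ S`: `S' ∪ K_Sᶜ ⊇ S' ∪ (M \ X₀)` is AC, and
`K_S \ S' ⊆ X₀ ∩ (M \ S')` has cell `≤ ab|c|y ∧ (co-cell of S') = ⊥`.) [this work] -/
theorem exists_odd_good_symmetric_abcy (a b c y : Fin n) (C M : Finset (Sym2 (Fin n)))
    (ι : Finset (Sym2 (Fin n)) → Fin 15) (hι : ∀ T : Finset (Sym2 (Fin n)), prof a b c y ↑(C ∪ T) = pp (ι T))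
    (𝒮 : Finset (Finset (Sym2 (Fin n)))) (h𝒮M : ∀ S ∈ 𝒮, S ⊆ M)
    (htypes : ∀ S ∈ 𝒮, (ι S, ι (M \ S)) ∈ ({(6, 7), (5, 7), (11, 9), (11, 8), (6, 8), (6, 1), (8, 1)} : Finset (Fin 15 × Fin 15)))
    (X₀ : Finset (Sym2 (Fin n))) (hX₀ : X₀ ∈ 𝒮) (hX₀c : ι X₀ = 6)
    (hmax : ∀ S ∈ 𝒮, X₀ ⊆ S → S = X₀)
    (hlink : ∀ S ∈ 𝒮, isAC (ι (S ∪ (M \ X₀)))) :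
    ∃ T ∈ goods (fun T : Finset (Sym2 (Fin n)) => ι (T ∩ M)), Odd #(𝒮.filter (fun S => S ⊆ T)) := by
  classical
  set κ : Finset (Sym2 (Fin n)) → Fin 15 := fun T => ι (T ∩ M) with hκ
  have hmono : ∀ A B : Finset (Sym2 (Fin n)), A ⊆ B → ple (κ A) (κ B) = true := fun A B hAB =>
    ple_fibreMap a b c y C ι hι (Finset.inter_subset_inter hAB (subset_refl M))
  have hκS : ∀ S, S ⊆ M → κ S = ι S := fun S hS => by simp only [hκ, Finset.inter_eq_left.2 hS]
  have hκSc : ∀ S : Finset (Sym2 (Fin n)), κ Sᶜ = ι (M \ S) := fun S => by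
    simp only [hκ]; congr 1; ext e; simp [Finset.mem_sdiff, Finset.mem_inter, and_comm]
  have hX₀M : X₀ ⊆ M := h𝒮M X₀ hX₀
  refine exists_odd_good_of_handshake (goods κ) (goods_upper κ hmono) 𝒮 ∅ X₀ hX₀ (Finset.empty_subset _) hmax ?_
  intro X hX _ S hS
  rw [Finset.empty_union]
  have hSM : S ⊆ M := h𝒮M S hS
  unfold goods
  rw [Finset.mem_filter]
  refine ⟨Finset.mem_univ _, ?_, ?_⟩
  · -- the join side: `S ∪ (M \ X₀) ⊆ (S ∪ (X₀ \ X)ᶜ) ∩ M`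
    have hsub : S ∪ (M \ X₀) ⊆ (S ∪ (X₀ \ X)ᶜ) ∩ M := by
      intro e he
      rw [Finset.mem_inter, Finset.mem_union, Finset.mem_compl, Finset.mem_sdiff]
      rcases Finset.mem_union.1 he with heS | heM
      · exact ⟨Or.inl heS, hSM heS⟩
      · rw [Finset.mem_sdiff] at heM
        exact ⟨Or.inr (fun h => heM.2 h.1), heM.1⟩
    have hple : ple (ι (S ∪ (M \ X₀))) (κ (S ∪ (X₀ \ X)ᶜ)) = true := ple_fibreMap a b c y C ι hι hsub
    exact isAC_of_ple _ _ hple (hlink S hS)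
  · -- the meet side: `(S ∪ (X₀ \ X)ᶜ)ᶜ ⊆ X₀` and `⊆ Sᶜ`
    have hc1 : (S ∪ (X₀ \ X)ᶜ)ᶜ ⊆ X₀ := by
      intro e he
      rw [Finset.mem_compl, Finset.mem_union, not_or, Finset.mem_compl, not_not, Finset.mem_sdiff] at he
      exact he.2.1
    have hc2 : (S ∪ (X₀ \ X)ᶜ)ᶜ ⊆ Sᶜ := Finset.compl_subset_compl.2 Finset.subset_union_left
    have h6 : ple (κ (S ∪ (X₀ \ X)ᶜ)ᶜ) 6 = true := by
      have h := hmono _ _ hc1; rwa [hκS X₀ hX₀M, hX₀c] at h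
    have hl : ple (κ (S ∪ (X₀ \ X)ᶜ)ᶜ) (ι (M \ S)) = true := by
      have h := hmono _ _ hc2; rwa [hκSc S] at h
    have hdb := (compatible_bLobe_table.1 (ι S, ι (M \ S)) (htypes S hS)).2
    unfold downBot at hdb
    rw [decide_eq_true_iff] at hdb
    exact hdb _ hl h6

/-- **A `Pb`-member contained in no other member certifies every single-source family.**  Graph fibre; `𝒮` of the seven
types; `p ∈ 𝒮` with `ι p = ab|c|y`, `ι (M \ p) = a|bcy`, and no other member contains `p`.  Then some fat good contains
an odd number of members (decision-list branch B1 without the proviso `K5 ∉ τ`). [this work] -/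
theorem exists_odd_good_of_maximal_Pb (a b c y : Fin n) (C M : Finset (Sym2 (Fin n)))
    (ι : Finset (Sym2 (Fin n)) → Fin 15) (hι : ∀ T : Finset (Sym2 (Fin n)), prof a b c y ↑(C ∪ T) = pp (ι T))
    (𝒮 : Finset (Finset (Sym2 (Fin n)))) (h𝒮M : ∀ S ∈ 𝒮, S ⊆ M)
    (htypes : ∀ S ∈ 𝒮, (ι S, ι (M \ S)) ∈ ({(6, 7), (5, 7), (11, 9), (11, 8), (6, 8), (6, 1), (8, 1)} : Finset (Fin 15 × Fin 15)))
    (p : Finset (Sym2 (Fin n))) (hp : p ∈ 𝒮) (hpc : ι p = 6) (hpcc : ι (M \ p) = 7)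
    (hmax : ∀ S ∈ 𝒮, p ⊆ S → S = p) :
    ∃ T ∈ goods (fun T : Finset (Sym2 (Fin n)) => ι (T ∩ M)), Odd #(𝒮.filter (fun S => S ⊆ T)) := by
  refine exists_odd_good_symmetric_abcy a b c y C M ι hι 𝒮 h𝒮M htypes p hp hpc hmax fun S hS => ?_
  have hu := (compatible_bLobe_table.1 (ι S, ι (M \ S)) (htypes S hS)).1
  unfold upAC at hu
  rw [decide_eq_true_iff] at hu
  refine hu _ (ple_fibreMap a b c y C ι hι Finset.subset_union_left) ?_
  have h := ple_fibreMap a b c y C ι hι (Finset.subset_union_right : M \ p ⊆ S ∪ (M \ p))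
  rwa [hpcc] at h

/-- **A maximal `K4`-base certifies as soon as every `K4s`-member is linked.**  Graph fibre; `𝒮` of the seven types;
`X₀ ∈ 𝒮` of type `K4` (`ι X₀ = ab|c|y`, `ι (M \ X₀) = ay|bc`) contained in no other member; and every member `W` of cell
`ay|bc` has `ι (W ∪ (M \ X₀))` AC (`a ~ b` in `(M \ X₀) ∪ W`).  Then some fat good contains an odd number of members.
[this work] -/
theorem exists_odd_good_K4base_linked (a b c y : Fin n) (C M : Finset (Sym2 (Fin n)))
    (ι : Finset (Sym2 (Fin n)) → Fin 15) (hι : ∀ T : Finset (Sym2 (Fin n)), prof a b c y ↑(C ∪ T) = pp (ι T))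
    (𝒮 : Finset (Finset (Sym2 (Fin n)))) (h𝒮M : ∀ S ∈ 𝒮, S ⊆ M)
    (htypes : ∀ S ∈ 𝒮, (ι S, ι (M \ S)) ∈ ({(6, 7), (5, 7), (11, 9), (11, 8), (6, 8), (6, 1), (8, 1)} : Finset (Fin 15 × Fin 15)))
    (X₀ : Finset (Sym2 (Fin n))) (hX₀ : X₀ ∈ 𝒮) (hX₀c : ι X₀ = 6) (hX₀cc : ι (M \ X₀) = 8)
    (hmax : ∀ S ∈ 𝒮, X₀ ⊆ S → S = X₀)
    (hlink : ∀ S ∈ 𝒮, ι S = 8 → isAC (ι (S ∪ (M \ X₀)))) :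
    ∃ T ∈ goods (fun T : Finset (Sym2 (Fin n)) => ι (T ∩ M)), Odd #(𝒮.filter (fun S => S ⊆ T)) := by
  refine exists_odd_good_symmetric_abcy a b c y C M ι hι 𝒮 h𝒮M htypes X₀ hX₀ hX₀c hmax fun S hS => ?_
  by_cases h8 : ι S = 8
  · exact hlink S hS h8
  · have hu := upAC_eight_table (ι S, ι (M \ S)) (htypes S hS) h8
    unfold upAC at hu
    rw [decide_eq_true_iff] at hu
    refine hu _ (ple_fibreMap a b c y C ι hι Finset.subset_union_left) ?_
    have h := ple_fibreMap a b c y C ι hι (Finset.subset_union_right : M \ X₀ ⊆ S ∪ (M \ X₀))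
    rwa [hX₀cc] at h

end TwoCopyMono

end Summit.CriticalPhenomena.PercolationContinuityZ3.Theorems
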